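import Literature.MathematicalPhysics.QuantumManyBody.PeriodicBoseGas
import Summits.AtomisticToContinuum.BoseEinsteinCondensation.Theorems.BECThomsonPrinciplePeriodicToDirichletInnerFlatToBEC
import Mathlib.MeasureTheory.Measure.WithDensity
import Mathlib.Analysis.SpecialFunctions.Exp
import Mathlib.Analysis.SpecialFunctions.Log.Basic
import Literature.MathematicalPhysics.QuantumManyBody.LiebYngvasonCellMethod
import Literature.MathematicalPhysics.QuantumManyBody.GroundState
import Literature.MathematicalPhysics.QuantumManyBody.SwapPurity
import Literature.MathematicalPhysics.QuantumManyBody.BoseGasDirichletWall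
import Summits.AtomisticToContinuum.BoseEinsteinCondensation.Theorems.BECInsertionVarianceGroundStateAccessibleExistence
import Mathlib.MeasureTheory.Measure.Prod
import Summits.AtomisticToContinuum.BoseEinsteinCondensation.Theorems.BECInsertionCorrectorBoundaryTransferWeakFreeShape

/-!
# Crux `BoundaryTransferWeak` (stmt-AtomisticToContinuum-0827), line `Sketch` (coupled-bath-relocation):
# stub `stub_freeCoupledRelocation` — deterministic core of the free good event

The `v = 0` instance of the line's research stub `CoupledRelocationBound` is assembled from the free
ground-state identification (S2b) and the free torus slice typicality (S3).  This file contains the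
DETERMINISTIC heart of that assembly, with no ground state and no torus state in sight: given, on the
box of side `L`, a "box slice" `ψ ≥ 0` that agrees almost everywhere with a reference profile `g ≥ 0`
enjoying the three shape bounds of the sine mode on the inner cube `C = (L/4, 3L/4)³`
(`g y ≤ K g x` for `x ∈ C`, `g² ≥ m₀` on `C`, `g² ≤ 8 m₀` everywhere), and a "torus slice" `φ` lying in a
band `[μ/2, 3μ/2]` off a small exceptional set `B` (the output of S3), the exceptional sets
`S := C ∩ (B ∪ {ψ ≠ g})`, `T := B ∪ {ψ ≠ g}` satisfy every clause of the line's good event `GoodPair`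
(v2) with cost bound `e^M = 3K`. [folklore]
-/

noncomputable section

namespace Summit.AtomisticToContinuum.BoseEinsteinCondensation.CoupledBaths

namespace FreeCoupledRelocation

open Literature.MathematicalPhysics.QuantumManyBody.BoseGas MeasureTheory
open scoped ENNReal NNReal
open ENNReal (ofReal)

variable {L : ℝ}

/-- The inner cube `(L/4, 3L/4)³` lies in the cell `[0, L)³`. [folklore] -/
theorem innerCube_subset_cell : ∀ {L : ℝ}, 0 < L →
    {x : Space | ∀ t, x t ∈ Set.Ioo (1 / 4 * L) (L - 1 / 4 * L)} ⊆ cell L := by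
  intro L hL x hx t
  obtain ⟨h1, h2⟩ := hx t
  exact ⟨by nlinarith, by nlinarith⟩

/-- `|(L/4, 3L/4)³| = L³/8` as a real number inside `ofReal`. [folklore] -/
theorem volume_innerCube_quarter (hL : 0 < L) :
    volume {x : Space | ∀ t, x t ∈ Set.Ioo (1 / 4 * L) (L - 1 / 4 * L)} = ofReal (L ^ 3 / 8) := by
  rw [TorusInTheBox.volume_innerCube (1 / 4) L, ← ENNReal.ofReal_pow (by nlinarith)]
  congr 1
  ring

/-- A constant lower bound integrates: `ofReal c * volume A ≤ ∫_A F` when `ofReal c ≤ F` on `A`.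
[folklore] -/
theorem ofReal_mul_volume_le_setLIntegral {A : Set Space} (hA : MeasurableSet A) {F : Space → ℝ≥0∞}
    {c : ℝ} (h : ∀ x ∈ A, ofReal c ≤ F x) : ofReal c * volume A ≤ ∫⁻ x in A, F x := by
  calc ofReal c * volume A = ∫⁻ _ in A, ofReal c := by rw [setLIntegral_const, mul_comm]
    _ ≤ ∫⁻ x in A, F x := setLIntegral_mono' hA h

/-- A constant upper bound integrates: `∫_A F ≤ ofReal c * volume A` when `F ≤ ofReal c` on `A`.
[folklore] -/
theorem setLIntegral_le_ofReal_mul_volume {A : Set Space} (hA : MeasurableSet A) {F : Space → ℝ≥0∞}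
    {c : ℝ} (h : ∀ x ∈ A, F x ≤ ofReal c) : ∫⁻ x in A, F x ≤ ofReal c * volume A := by
  calc ∫⁻ x in A, F x ≤ ∫⁻ _ in A, ofReal c := setLIntegral_mono' hA h
    _ = ofReal c * volume A := by rw [setLIntegral_const, mul_comm]


/-- On a null set every `ℝ≥0∞` integral vanishes. [folklore] -/
theorem setLIntegral_null {N : Set Space} (hN : volume N = 0) (F : Space → ℝ≥0∞) :
    ∫⁻ x in N, F x = 0 := by
  rw [Measure.restrict_eq_zero.2 hN, lintegral_zero_measure]

/-- Integrals over `A` of two a.e.-equal nonnegative real functions, squared inside `ofReal`, agree.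
[folklore] -/
theorem setLIntegral_sq_congr_ae {ψ g : Space → ℝ} (hae : ψ =ᵐ[volume] g) (A : Set Space) :
    ∫⁻ x in A, ofReal (ψ x) ^ 2 = ∫⁻ x in A, ofReal (g x) ^ 2 := by
  refine lintegral_congr_ae (ae_restrict_of_ae ?_)
  filter_upwards [hae] with x hx
  rw [hx]

/-- **Deterministic core of the free good event.**  On the box of side `L` let the box slice `ψ ≥ 0`
agree a.e. with a profile `g ≥ 0` satisfying the three sine-mode shape bounds on the inner cube
`C = (L/4, 3L/4)³` with constants `K, m₀ > 0`, and let the torus slice `φ ≥ 0` lie in the band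
`[μ/2, 3μ/2]` on `cell L ∖ B` with `|B| ≤ ε₁ L³` and `∫_B φ² ≤ ε₁ μ² L³`, where `ε₁ ≤ min(ε, 1)/64`.
Then `S := C ∩ (B ∪ {ψ ≠ g})` and `T := B ∪ {ψ ≠ g}` witness all exceptional-set clauses of the line's
good event with `e^M = 3K`. [folklore] -/
theorem core (hL : 0 < L) {ε ε₁ K m₀ μ : ℝ} (hε : 0 < ε) (hε₁0 : 0 ≤ ε₁) (hε₁ : ε₁ ≤ ε / 64)
    (hε₁' : ε₁ ≤ 1 / 64) (hK : 0 < K) (hm₀ : 0 < m₀) (hμ : 0 < μ)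
    {ψ g φ : Space → ℝ} (hψm : Measurable ψ) (hgm : Measurable g)
    (hg0 : ∀ x, 0 ≤ g x) (hφ0 : ∀ x, 0 ≤ φ x) (hae : ψ =ᵐ[volume] g)
    (hgK : ∀ x ∈ {x : Space | ∀ t, x t ∈ Set.Ioo (1 / 4 * L) (L - 1 / 4 * L)}, ∀ y, g y ≤ K * g x)
    (hgC : ∀ x ∈ {x : Space | ∀ t, x t ∈ Set.Ioo (1 / 4 * L) (L - 1 / 4 * L)}, m₀ ≤ g x ^ 2)
    (hg8 : ∀ y, g y ^ 2 ≤ 8 * m₀) (hgsupp : ∀ y, y ∉ box L → g y = 0)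
    {B : Set Space} (hBm : MeasurableSet B) (hBvol : volume B ≤ ofReal (ε₁ * L ^ 3))
    (hBφ : ∫⁻ y in B, ofReal (φ y) ^ 2 ≤ ofReal (ε₁ * μ ^ 2 * L ^ 3))
    (hband : ∀ y ∈ cell L \ B, μ / 2 ≤ φ y ∧ φ y ≤ 3 * μ / 2) :
    0 < ∫⁻ x in {x : Space | ∀ t, x t ∈ Set.Ioo (1 / 4 * L) (L - 1 / 4 * L)}, ofReal (ψ x) ^ 2 ∧
    ∫⁻ x in {x : Space | ∀ t, x t ∈ Set.Ioo (1 / 4 * L) (L - 1 / 4 * L)}, ofReal (ψ x) ^ 2 < ⊤ ∧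
    ∫⁻ x, ofReal (ψ x) ^ 2 < ⊤ ∧
    ∃ S ⊆ {x : Space | ∀ t, x t ∈ Set.Ioo (1 / 4 * L) (L - 1 / 4 * L)},
      MeasurableSet S ∧
      volume S ≤ ofReal ε * volume {x : Space | ∀ t, x t ∈ Set.Ioo (1 / 4 * L) (L - 1 / 4 * L)} ∧
      ∫⁻ x in S, ofReal (ψ x) ^ 2 ≤
        ofReal ε * ∫⁻ x in {x : Space | ∀ t, x t ∈ Set.Ioo (1 / 4 * L) (L - 1 / 4 * L)},
          ofReal (ψ x) ^ 2 ∧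
      ∫⁻ y in S, ofReal (φ y) ^ 2 ≤
        ofReal ε * ∫⁻ y in {x : Space | ∀ t, x t ∈ Set.Ioo (1 / 4 * L) (L - 1 / 4 * L)},
          ofReal (φ y) ^ 2 ∧
      (∀ x ∈ {x : Space | ∀ t, x t ∈ Set.Ioo (1 / 4 * L) (L - 1 / 4 * L)} \ S,
        ∀ y ∈ {x : Space | ∀ t, x t ∈ Set.Ioo (1 / 4 * L) (L - 1 / 4 * L)} \ S,
          ψ x * φ y ≤ Real.exp (Real.log (3 * K)) * (ψ y * φ x)) ∧
      ∃ T : Set Space, MeasurableSet T ∧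
        ∫⁻ y in T, ofReal (ψ y) ^ 2 ≤ ofReal ε * ∫⁻ x, ofReal (ψ x) ^ 2 ∧
        ∀ x ∈ {x : Space | ∀ t, x t ∈ Set.Ioo (1 / 4 * L) (L - 1 / 4 * L)} \ S,
          ∀ y ∈ (cell L \ {x : Space | ∀ t, x t ∈ Set.Ioo (1 / 4 * L) (L - 1 / 4 * L)}) \ T,
            ψ y * φ x ≤ Real.exp (Real.log (3 * K)) * (ψ x * φ y) := by
  set C : Set Space := {x : Space | ∀ t, x t ∈ Set.Ioo (1 / 4 * L) (L - 1 / 4 * L)} with hCdef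
  have hCm : MeasurableSet C := TorusInTheBox.measurableSet_innerCube (1 / 4) L
  have hCvol : volume C = ofReal (L ^ 3 / 8) := volume_innerCube_quarter hL
  have hCcell : C ⊆ cell L := innerCube_subset_cell hL
  -- the null set where the slice is not the profile
  set N : Set Space := {x | ψ x ≠ g x} with hNdef
  have hNm : MeasurableSet N := (measurableSet_eq_fun hψm hgm).compl
  have hN0 : volume N = 0 := ae_iff.1 hae
  have hexp : Real.exp (Real.log (3 * K)) = 3 * K := Real.exp_log (by positivity)
  have hL3 : 0 < L ^ 3 := by positivity
  -- pointwise facts off the exceptional sets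
  have hψg : ∀ x, x ∉ N → ψ x = g x := fun x hx => by
    by_contra h
    exact hx h
  -- volumes
  have hBN : volume (B ∪ N) ≤ ofReal (ε₁ * L ^ 3) :=
    (measure_union_le B N).trans (by rw [hN0, add_zero]; exact hBvol)
  -- square conversions
  have hsq : ∀ x, ofReal (g x) ^ 2 = ofReal (g x ^ 2) := fun x => (ENNReal.ofReal_pow (hg0 x) 2).symm
  have hsqφ : ∀ x, ofReal (φ x) ^ 2 = ofReal (φ x ^ 2) := fun x =>
    (ENNReal.ofReal_pow (hφ0 x) 2).symm
  -- integrals of `g²` over small sets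
  have hg_small : ∀ {A : Set Space}, MeasurableSet A → volume A ≤ ofReal (ε₁ * L ^ 3) →
      ∫⁻ x in A, ofReal (g x) ^ 2 ≤ ofReal (8 * m₀ * (ε₁ * L ^ 3)) := by
    intro A hA hAvol
    calc ∫⁻ x in A, ofReal (g x) ^ 2 ≤ ofReal (8 * m₀) * volume A :=
          setLIntegral_le_ofReal_mul_volume hA fun x _ => by rw [hsq]; exact ENNReal.ofReal_le_ofReal (hg8 x)
      _ ≤ ofReal (8 * m₀) * ofReal (ε₁ * L ^ 3) := by gcongr
      _ = ofReal (8 * m₀ * (ε₁ * L ^ 3)) := (ENNReal.ofReal_mul (by positivity)).symm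
  -- integral of `g²` over `C` from below
  have hg_C : ofReal (m₀ * (L ^ 3 / 8)) ≤ ∫⁻ x in C, ofReal (g x) ^ 2 := by
    calc ofReal (m₀ * (L ^ 3 / 8)) = ofReal m₀ * volume C := by
          rw [hCvol, ENNReal.ofReal_mul hm₀.le]
      _ ≤ ∫⁻ x in C, ofReal (g x) ^ 2 :=
          ofReal_mul_volume_le_setLIntegral hCm fun x hx => by rw [hsq]; exact ENNReal.ofReal_le_ofReal (hgC x hx)
  have hkey : 8 * m₀ * (ε₁ * L ^ 3) ≤ ε * (m₀ * (L ^ 3 / 8)) := by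
    calc 8 * m₀ * (ε₁ * L ^ 3) = 8 * (m₀ * L ^ 3) * ε₁ := by ring
      _ ≤ 8 * (m₀ * L ^ 3) * (ε / 64) := by gcongr
      _ = ε * (m₀ * (L ^ 3 / 8)) := by ring
  -- the total mass of `g²` is finite (bounded, supported in the box)
  have hall : ∫⁻ x, ofReal (ψ x) ^ 2 = ∫⁻ x, ofReal (g x) ^ 2 := by
    have := setLIntegral_sq_congr_ae hae Set.univ
    simpa only [Measure.restrict_univ] using this
  have hfin : ∫⁻ x, ofReal (g x) ^ 2 < ⊤ := by
    have hsupp : Function.support (fun x => ofReal (g x) ^ 2) ⊆ box L := by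
      intro x hx
      by_contra hxb
      exact hx (by simp [hgsupp x hxb])
    rw [← setLIntegral_eq_of_support_subset hsupp]
    calc ∫⁻ x in box L, ofReal (g x) ^ 2 ≤ ofReal (8 * m₀) * volume (box L) :=
          setLIntegral_le_ofReal_mul_volume (measurableSet_box L) fun x _ => by
            rw [hsq]; exact ENNReal.ofReal_le_ofReal (hg8 x)
      _ ≤ ofReal (8 * m₀) * volume (cell L) := by
          gcongr
          exact fun x hx t => ⟨(hx t).1.le, (hx t).2⟩
      _ < ⊤ := by
          rw [volume_cell]
          exact ENNReal.mul_lt_top ENNReal.ofReal_lt_top (ENNReal.pow_lt_top ENNReal.ofReal_lt_top)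
  have hposC : 0 < ∫⁻ x in C, ofReal (ψ x) ^ 2 := by
    rw [setLIntegral_sq_congr_ae hae]
    exact lt_of_lt_of_le (ENNReal.ofReal_pos.2 (by positivity)) hg_C
  refine ⟨hposC, lt_of_le_of_lt (setLIntegral_le_lintegral _ _) (hall ▸ hfin), hall ▸ hfin,
    C ∩ (B ∪ N), Set.inter_subset_left, hCm.inter (hBm.union hNm), ?_, ?_, ?_, ?_,
    B ∪ N, hBm.union hNm, ?_, ?_⟩
  · -- |S| ≤ ε |C|
    calc volume (C ∩ (B ∪ N)) ≤ volume (B ∪ N) := measure_mono Set.inter_subset_right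
      _ ≤ ofReal (ε₁ * L ^ 3) := hBN
      _ ≤ ofReal (ε * (L ^ 3 / 8)) := ENNReal.ofReal_le_ofReal (by nlinarith)
      _ = ofReal ε * volume C := by rw [hCvol, ENNReal.ofReal_mul hε.le]
  · -- ∫_S ψ² ≤ ε ∫_C ψ²
    rw [setLIntegral_sq_congr_ae hae, setLIntegral_sq_congr_ae hae]
    calc ∫⁻ x in C ∩ (B ∪ N), ofReal (g x) ^ 2 ≤ ofReal (8 * m₀ * (ε₁ * L ^ 3)) :=
          hg_small (hCm.inter (hBm.union hNm))
            ((measure_mono Set.inter_subset_right).trans hBN)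
      _ ≤ ofReal (ε * (m₀ * (L ^ 3 / 8))) := ENNReal.ofReal_le_ofReal hkey
      _ = ofReal ε * ofReal (m₀ * (L ^ 3 / 8)) := ENNReal.ofReal_mul hε.le
      _ ≤ ofReal ε * ∫⁻ x in C, ofReal (g x) ^ 2 := by gcongr
  · -- ∫_S φ² ≤ ε ∫_C φ²
    have hup : ∫⁻ y in C ∩ (B ∪ N), ofReal (φ y) ^ 2 ≤ ofReal (ε₁ * μ ^ 2 * L ^ 3) := by
      calc ∫⁻ y in C ∩ (B ∪ N), ofReal (φ y) ^ 2 ≤ ∫⁻ y in B ∪ N, ofReal (φ y) ^ 2 :=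
            lintegral_mono_set Set.inter_subset_right
        _ ≤ (∫⁻ y in B, ofReal (φ y) ^ 2) + ∫⁻ y in N, ofReal (φ y) ^ 2 := lintegral_union_le _ _ _
        _ ≤ ofReal (ε₁ * μ ^ 2 * L ^ 3) := by rw [setLIntegral_null hN0, add_zero]; exact hBφ
    have hlow : ofReal (μ ^ 2 / 4 * (L ^ 3 / 8 - ε₁ * L ^ 3)) ≤ ∫⁻ y in C, ofReal (φ y) ^ 2 := by
      have hvol : ofReal (L ^ 3 / 8 - ε₁ * L ^ 3) ≤ volume (C \ B) := by
        calc ofReal (L ^ 3 / 8 - ε₁ * L ^ 3) = ofReal (L ^ 3 / 8) - ofReal (ε₁ * L ^ 3) :=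
              ENNReal.ofReal_sub _ (by positivity)
          _ ≤ volume C - volume B := by rw [hCvol]; exact tsub_le_tsub_left hBvol _
          _ ≤ volume (C \ B) := le_measure_sdiff
      calc ofReal (μ ^ 2 / 4 * (L ^ 3 / 8 - ε₁ * L ^ 3))
          = ofReal (μ ^ 2 / 4) * ofReal (L ^ 3 / 8 - ε₁ * L ^ 3) := ENNReal.ofReal_mul (by positivity)
        _ ≤ ofReal (μ ^ 2 / 4) * volume (C \ B) := by gcongr
        _ ≤ ∫⁻ y in C \ B, ofReal (φ y) ^ 2 := by
            refine ofReal_mul_volume_le_setLIntegral (hCm.diff hBm) fun y hy => ?_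
            rw [hsqφ]
            have hb := (hband y ⟨hCcell hy.1, hy.2⟩).1
            exact ENNReal.ofReal_le_ofReal (by nlinarith [hμ])
        _ ≤ ∫⁻ y in C, ofReal (φ y) ^ 2 := lintegral_mono_set fun y hy => hy.1
    calc ∫⁻ y in C ∩ (B ∪ N), ofReal (φ y) ^ 2 ≤ ofReal (ε₁ * μ ^ 2 * L ^ 3) := hup
      _ ≤ ofReal (ε * (μ ^ 2 / 4 * (L ^ 3 / 8 - ε₁ * L ^ 3))) := by
          refine ENNReal.ofReal_le_ofReal ?_
          have hμ2 : 0 < μ ^ 2 := by positivity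
          nlinarith [mul_pos hμ2 hL3, mul_pos (mul_pos hε hμ2) hL3]
      _ = ofReal ε * ofReal (μ ^ 2 / 4 * (L ^ 3 / 8 - ε₁ * L ^ 3)) := ENNReal.ofReal_mul hε.le
      _ ≤ ofReal ε * ∫⁻ y in C, ofReal (φ y) ^ 2 := by gcongr
  · -- two-sided bound on `(C ∖ S)²`
    intro x hx y hy
    have hxC : x ∈ C := hx.1
    have hyC : y ∈ C := hy.1
    have hxBN : x ∉ B ∪ N := fun h => hx.2 ⟨hxC, h⟩
    have hyBN : y ∉ B ∪ N := fun h => hy.2 ⟨hyC, h⟩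
    rw [Set.mem_union, not_or] at hxBN hyBN
    rw [hψg x hxBN.2, hψg y hyBN.2, hexp]
    obtain ⟨hφx, -⟩ := hband x ⟨hCcell hxC, hxBN.1⟩
    obtain ⟨-, hφy⟩ := hband y ⟨hCcell hyC, hyBN.1⟩
    have hgxy : g x ≤ K * g y := hgK y hyC x
    calc g x * φ y ≤ (K * g y) * (3 * μ / 2) :=
          mul_le_mul hgxy hφy (hφ0 y) (mul_nonneg hK.le (hg0 y))
      _ = 3 * K * (g y * (μ / 2)) := by ring
      _ ≤ 3 * K * (g y * φ x) := by
          have := mul_le_mul_of_nonneg_left hφx (hg0 y)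
          nlinarith [this, hK]
  · -- ∫_T ψ² ≤ ε ∫ ψ²
    rw [setLIntegral_sq_congr_ae hae, hall]
    calc ∫⁻ x in B ∪ N, ofReal (g x) ^ 2 ≤ ofReal (8 * m₀ * (ε₁ * L ^ 3)) := hg_small (hBm.union hNm) hBN
      _ ≤ ofReal (ε * (m₀ * (L ^ 3 / 8))) := ENNReal.ofReal_le_ofReal hkey
      _ = ofReal ε * ofReal (m₀ * (L ^ 3 / 8)) := ENNReal.ofReal_mul hε.le
      _ ≤ ofReal ε * ∫⁻ x in C, ofReal (g x) ^ 2 := by gcongr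
      _ ≤ ofReal ε * ∫⁻ x, ofReal (g x) ^ 2 :=
          mul_le_mul' le_rfl (setLIntegral_le_lintegral _ _)
  · -- one-directional bound from `C ∖ S` to `(cell ∖ C) ∖ T`
    intro x hx y hy
    have hxC : x ∈ C := hx.1
    have hxBN : x ∉ B ∪ N := fun h => hx.2 ⟨hxC, h⟩
    have hyBN : y ∉ B ∪ N := hy.2
    rw [Set.mem_union, not_or] at hxBN hyBN
    rw [hψg x hxBN.2, hψg y hyBN.2, hexp]
    obtain ⟨-, hφx⟩ := hband x ⟨hCcell hxC, hxBN.1⟩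
    obtain ⟨hφy, -⟩ := hband y ⟨hy.1.1, hyBN.1⟩
    have hgyx : g y ≤ K * g x := hgK x hxC y
    calc g y * φ x ≤ (K * g x) * (3 * μ / 2) :=
          mul_le_mul hgyx hφx (hφ0 x) (mul_nonneg hK.le (hg0 x))
      _ = 3 * K * (g x * (μ / 2)) := by ring
      _ ≤ 3 * K * (g x * φ y) := by
          have := mul_le_mul_of_nonneg_left hφy (hg0 x)
          nlinarith [this, hK]


/-! ### Shape of the sine mode `u_L(x) = ∏ₖ √(2/L) sin(π xₖ/L)` on the inner cube -/

/-- On `(L/4, 3L/4)`: `sin(π s/L) ≥ √2/2`. [folklore] -/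
theorem sqrt_two_div_two_le_sin (hL : 0 < L) {s : ℝ} (hs : s ∈ Set.Ioo (1 / 4 * L) (L - 1 / 4 * L)) :
    Real.sqrt 2 / 2 ≤ Real.sin (Real.pi * s / L) := by
  -- adapted from …Theorems/BECInsertionCorrectorBoundaryTransferWeakFreeShape.lean (private there)
  obtain ⟨h1, h2⟩ := hs
  have hθ1 : Real.pi / 4 < Real.pi * s / L := by
    rw [lt_div_iff₀ hL]; nlinarith [Real.pi_pos]
  have hθ2 : Real.pi * s / L < 3 * Real.pi / 4 := by
    rw [div_lt_iff₀ hL]; nlinarith [Real.pi_pos]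
  rw [← Real.sin_pi_div_four]
  rcases le_or_gt (Real.pi * s / L) (Real.pi / 2) with h | h
  · exact Real.sin_le_sin_of_le_of_le_pi_div_two (by linarith [Real.pi_pos]) h hθ1.le
  · rw [← Real.sin_pi_sub (Real.pi * s / L)]
    exact Real.sin_le_sin_of_le_of_le_pi_div_two (by linarith [Real.pi_pos]) (by linarith)
      (by linarith)

/-- The sine mode is continuous, hence its zero-extension off the box is measurable. [folklore] -/
theorem measurable_indicator_sineMode (L : ℝ) :
    Measurable (Set.indicator (box L)
      (fun x : Space => ∏ k : Fin 3, Real.sqrt (2 / L) * Real.sin (Real.pi * x k / L))) := by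
  refine (Continuous.measurable ?_).indicator (measurableSet_box L)
  exact continuous_finsetProd _ fun k _ => by fun_prop

/-- The zero-extended sine mode is nonnegative. [folklore] -/
theorem indicator_sineMode_nonneg (hL : 0 < L) (y : Space) :
    0 ≤ Set.indicator (box L)
      (fun x : Space => ∏ k : Fin 3, Real.sqrt (2 / L) * Real.sin (Real.pi * x k / L)) y := by
  by_cases hy : y ∈ box L
  · rw [Set.indicator_of_mem hy]
    refine Finset.prod_nonneg fun k _ => mul_nonneg (Real.sqrt_nonneg _) ?_
    obtain ⟨h1, h2⟩ := hy k
    refine Real.sin_nonneg_of_nonneg_of_le_pi (by positivity) ?_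
    rw [div_le_iff₀ hL]; nlinarith [Real.pi_pos]
  · rw [Set.indicator_of_notMem hy]

/-- The zero-extended sine mode is strictly positive on the open box. [folklore] -/
theorem indicator_sineMode_pos (hL : 0 < L) {y : Space} (hy : y ∈ box L) :
    0 < Set.indicator (box L)
      (fun x : Space => ∏ k : Fin 3, Real.sqrt (2 / L) * Real.sin (Real.pi * x k / L)) y := by
  rw [Set.indicator_of_mem hy]
  refine Finset.prod_pos fun k _ => mul_pos (Real.sqrt_pos.2 (by positivity)) ?_
  obtain ⟨h1, h2⟩ := hy k
  refine Real.sin_pos_of_pos_of_lt_pi (by positivity) ?_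
  rw [div_lt_iff₀ hL]; nlinarith [Real.pi_pos]

/-- **Shape bound 1** (relocation cost of the sine mode): for `x` in the inner cube and ANY `y`,
`u_L(y) 1_{box}(y) ≤ e^{(3/2) log 2} · u_L(x)`. [folklore] -/
theorem indicator_sineMode_le (hL : 0 < L) {x : Space}
    (hx : x ∈ {x : Space | ∀ t, x t ∈ Set.Ioo (1 / 4 * L) (L - 1 / 4 * L)}) (y : Space) :
    Set.indicator (box L)
        (fun x : Space => ∏ k : Fin 3, Real.sqrt (2 / L) * Real.sin (Real.pi * x k / L)) y ≤
      Real.exp (3 / 2 * Real.log 2) *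
        Set.indicator (box L)
          (fun x : Space => ∏ k : Fin 3, Real.sqrt (2 / L) * Real.sin (Real.pi * x k / L)) x := by
  have hxbox : x ∈ box L := fun t => by
    obtain ⟨h1, h2⟩ := hx t
    exact ⟨by nlinarith, by nlinarith⟩
  by_cases hy : y ∈ box L
  · rw [Set.indicator_of_mem hy, Set.indicator_of_mem hxbox, Finset.prod_mul_distrib,
      Finset.prod_mul_distrib, mul_left_comm]
    refine mul_le_mul_of_nonneg_left ?_ (Finset.prod_nonneg fun _ _ => Real.sqrt_nonneg _)
    exact prod_sin_le_exp_mul_prod_sin L hL x y hx fun t => ⟨(hy t).1.le, (hy t).2.le⟩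
  · rw [Set.indicator_of_notMem hy]
    exact mul_nonneg (Real.exp_pos _).le (indicator_sineMode_nonneg hL x)

/-- **Shape bound 2**: on the inner cube `u_L² ≥ 1/L³` (each factor `(2/L) sin² ≥ 1/L`). [folklore] -/
theorem le_indicator_sineMode_sq (hL : 0 < L) {x : Space}
    (hx : x ∈ {x : Space | ∀ t, x t ∈ Set.Ioo (1 / 4 * L) (L - 1 / 4 * L)}) :
    1 / L ^ 3 ≤ Set.indicator (box L)
        (fun x : Space => ∏ k : Fin 3, Real.sqrt (2 / L) * Real.sin (Real.pi * x k / L)) x ^ 2 := by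
  have hxbox : x ∈ box L := fun t => by
    obtain ⟨h1, h2⟩ := hx t
    exact ⟨by nlinarith, by nlinarith⟩
  rw [Set.indicator_of_mem hxbox, ← Finset.prod_pow]
  have hfac : ∀ k : Fin 3, 1 / L ≤ (Real.sqrt (2 / L) * Real.sin (Real.pi * x k / L)) ^ 2 := by
    intro k
    have hs := sqrt_two_div_two_le_sin hL (hx k)
    have hs0 : 0 ≤ Real.sqrt 2 / 2 := by positivity
    have hsq : (Real.sqrt 2 / 2) ^ 2 ≤ Real.sin (Real.pi * x k / L) ^ 2 :=
      pow_le_pow_left₀ hs0 hs 2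
    rw [div_pow, Real.sq_sqrt (by norm_num : (0:ℝ) ≤ 2)] at hsq
    rw [mul_pow, Real.sq_sqrt (by positivity : (0:ℝ) ≤ 2 / L)]
    calc 1 / L = 2 / L * (2 / 2 ^ 2) := by ring
      _ ≤ 2 / L * Real.sin (Real.pi * x k / L) ^ 2 :=
          mul_le_mul_of_nonneg_left hsq (by positivity)
  calc 1 / L ^ 3 = ∏ _k : Fin 3, 1 / L := by
        rw [Finset.prod_const, Finset.card_univ, Fintype.card_fin]; ring
    _ ≤ ∏ k : Fin 3, (Real.sqrt (2 / L) * Real.sin (Real.pi * x k / L)) ^ 2 :=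
        Finset.prod_le_prod (fun _ _ => by positivity) fun k _ => hfac k

/-- **Shape bound 3**: everywhere `u_L² 1_{box} ≤ 8/L³` (each factor `(2/L) sin² ≤ 2/L`). [folklore] -/
theorem indicator_sineMode_sq_le (hL : 0 < L) (y : Space) :
    Set.indicator (box L)
        (fun x : Space => ∏ k : Fin 3, Real.sqrt (2 / L) * Real.sin (Real.pi * x k / L)) y ^ 2 ≤
      8 / L ^ 3 := by
  by_cases hy : y ∈ box L
  · rw [Set.indicator_of_mem hy, ← Finset.prod_pow]
    have hfac : ∀ k : Fin 3, (Real.sqrt (2 / L) * Real.sin (Real.pi * y k / L)) ^ 2 ≤ 2 / L := by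
      intro k
      rw [mul_pow, Real.sq_sqrt (by positivity : (0:ℝ) ≤ 2 / L)]
      calc 2 / L * Real.sin (Real.pi * y k / L) ^ 2 ≤ 2 / L * 1 :=
            mul_le_mul_of_nonneg_left (Real.sin_sq_le_one _) (by positivity)
        _ = 2 / L := mul_one _
    calc ∏ k : Fin 3, (Real.sqrt (2 / L) * Real.sin (Real.pi * y k / L)) ^ 2
        ≤ ∏ _k : Fin 3, 2 / L := Finset.prod_le_prod (fun _ _ => by positivity) fun k _ => hfac k
      _ = 8 / L ^ 3 := by rw [Finset.prod_const, Finset.card_univ, Fintype.card_fin]; ring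
  · rw [Set.indicator_of_notMem hy]
    have : 0 ≤ 8 / L ^ 3 := by positivity
    simpa using this

end FreeCoupledRelocation

end Summit.AtomisticToContinuum.BoseEinsteinCondensation.CoupledBaths

end
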